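import Summits.CriticalPhenomena.PercolationContinuityZ3.Theorems.PercNearOneGluingNoHeavyLowerTailSahiThreeCopyCellX6bMasks1
import Summits.CriticalPhenomena.PercolationContinuityZ3.Theorems.PercNearOneGluingNoHeavyLowerTailSahiThreeCopyHitPairsSix

/-!
# `NoHeavyLowerTail` (crux stmt-CriticalPhenomena-4575), Sahi programme: ★★★ **`LawGood 6 π 1_{X6b}` AT EVERY FRONT PROFILE**

Support file (Sahi cell, seat `prim-sahi-p1`, generation 65; `--supports stmt-CriticalPhenomena-4575`).  Assembly: the interior table (masks `prof6 m`,
`…CellX6bMasks*`) and the boundary (up-set sections on five coordinates, `frontGood_six_of_boundary`).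
COMPUTATIONAL content inherited (cell checks, section identities). [this work]
-/

namespace Summit.CriticalPhenomena.PercolationContinuityZ3.Theorems.SahiThreeCopy

open Finset Function Literature.Combinatorics.Sahi2008
open scoped BigOperators

/-- ★★ `LawGood 6 (prof6 m) 1_{X6b}` for EVERY interior front profile (all 64 masks). [this work] -/
theorem lawGood_X6b_prof (m : Fin 64) : LawGood 6 (prof6 m) (setInd X6bSet) := by
  fin_cases m
  · exact lawGood_X6b111111
  · exact lawGood_X6b211111
  · exact lawGood_X6bm2
  · exact lawGood_X6bm3
  · exact lawGood_X6bm4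
  · exact lawGood_X6bm5
  · exact lawGood_X6bm6
  · exact lawGood_X6bm7
  · exact lawGood_X6bm8
  · exact lawGood_X6bm9
  · exact lawGood_X6bm10
  · exact lawGood_X6bm11
  · exact lawGood_X6bm12
  · exact lawGood_X6bm13
  · exact lawGood_X6bm14
  · exact lawGood_X6bm15
  · exact lawGood_X6b111121
  · exact lawGood_X6b211121
  · exact lawGood_X6bm18
  · exact lawGood_X6bm19
  · exact lawGood_X6b112121
  · exact lawGood_X6b212121
  · exact lawGood_X6bm22
  · exact lawGood_X6bm23
  · exact lawGood_X6b111221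
  · exact lawGood_X6b211221
  · exact lawGood_X6bm26
  · exact lawGood_X6bm27
  · exact lawGood_X6b112221
  · exact lawGood_X6b212221
  · exact lawGood_X6b122221
  · exact lawGood_X6b222221
  · exact lawGood_X6b111112
  · exact lawGood_X6b211112
  · exact lawGood_X6bm34
  · exact lawGood_X6bm35
  · exact lawGood_X6bm36
  · exact lawGood_X6bm37
  · exact lawGood_X6bm38
  · exact lawGood_X6bm39
  · exact lawGood_X6bm40
  · exact lawGood_X6bm41
  · exact lawGood_X6bm42
  · exact lawGood_X6bm43
  · exact lawGood_X6bm44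
  · exact lawGood_X6bm45
  · exact lawGood_X6bm46
  · exact lawGood_X6bm47
  · exact lawGood_X6b111122
  · exact lawGood_X6b211122
  · exact lawGood_X6bm50
  · exact lawGood_X6bm51
  · exact lawGood_X6b112122
  · exact lawGood_X6b212122
  · exact lawGood_X6bm54
  · exact lawGood_X6bm55
  · exact lawGood_X6b111222
  · exact lawGood_X6b211222
  · exact lawGood_X6bm58
  · exact lawGood_X6bm59
  · exact lawGood_X6b112222
  · exact lawGood_X6b212222
  · exact lawGood_X6b122222
  · exact lawGood_X6b222222

/-- ★★★ **`LawGood 6 π 1_{X6b}` at EVERY front profile** (interior: the table; boundary: sections are up-sets on five coordinates). [this work] -/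
theorem lawGood_X6b_all (π : Fin 6 → ℕ) : LawGood 6 π (setInd X6bSet) :=
  lawGood_all_of_interior_of_boundary (k := 6) (f := setInd X6bSet)
    (fun m hm => lawGood_X6b_prof ⟨m, hm⟩)
    (fun π i hi => lawGood_of_frontGood (frontGood_six_of_boundary π i hi isUpperSet_X6bSet)) π

end Summit.CriticalPhenomena.PercolationContinuityZ3.Theorems.SahiThreeCopy
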